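import Mathlib
import Literature.Analysis.FluidPDE.TaoCascadeODEProofs
import HarnessLib

/-!
# `HeteroclinicTriggerChain` — crux `TriggerChainFrontStep` (item stmt-NavierStokesRegularity-22785):
  the NORMAL FORM of a table at a diagonal pure-mode saddle

Registered stub `stub_normal_form` of the crux skeleton (lead prover, reshaped from the planner's
`stub_chain_gap`): the purely ALGEBRAIC consequences of three clauses of the trigger-chain hypothesis —
(purity) pure-`i₀` families are zeros of `quadTerm 1 α`, (saddle) the polarisation of `quadTerm 1 α` at the
pure state `E₋ = δ_{(i₀,0)}` is diagonal with rate table `d`, together with Tao's symmetry (4.2) and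
cancellation (4.3) — for a four-mode table `α` on the shift set `S`.

CONCLUSIONS (all proved): `α i₀ i₀ · μ = 0` on `S`; every up-transfer entry with a carrier input
vanishes (`α i₀ j i (0,0,1) = α j i₀ i (0,0,1) = 0`), as do `α j i₀ i (1,0,0) = α i₀ j i (0,1,0) = 0`; the
carrier couples DIAGONALLY (`α i₀ j i (0,0,0) = α i₀ j i (1,0,0) = 0` for `j ≠ i`); the rate table is
`d i 0 = 2 α i₀ i i (0,0,0)`, `d i (-1) = 2^{-3/2} α i₀ i i (1,0,0)`, `d i n = 0` otherwise, and
`d i₀ ≡ 0` (the pure-mode family is a CENTRE direction — it is never hyperbolic); the carrier is fed only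
by diagonal pump pairs: `α j₁ j₂ i₀ (0,0,1) = α j₁ j₂ i₀ (0,0,0) = 0` for `j₁ ≠ j₂`,
`α j j i₀ (0,0,0) = -2 α i₀ j j (0,0,0) = -d j 0`, `α i₀ j j (1,0,0) = α j i₀ j (0,1,0) = -α j j i₀ (0,0,1)/2`
and `d j (-1) = -2^{-5/2} α j j i₀ (0,0,1)` (so `d ≤ 0` off the trigger forces nonnegative pump gains).

HONEST FRAMING: finite algebra of structure constants (MODEL lattice of Tao 2016 §4); nothing here is a
statement about the Navier–Stokes equations; no summit, rung or crux is proved by this file.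
-/

noncomputable section

set_option linter.dupNamespace false

namespace Summit.NavierStokesRegularity.NavierStokesRegularity.Theorems

open Literature.Analysis.FluidPDE Literature.Analysis.FluidPDE.TaoCascade

/-- The cascade nonlinearity written out over the four shifts of `S`: same-shell, the two back-reaction
monomials with the shell above, and the pump monomial of the shell below with ITS gain. [folklore] -/
theorem htcNF_quadTerm_expand (ε₀ : ℝ) {m : ℕ} (α : Fin m → Fin m → Fin m → ℤ × ℤ × ℤ → ℝ)
    (X : Fin m → ℤ → ℝ → ℝ) (i : Fin m) (n : ℤ) (t : ℝ) :
    quadTerm ε₀ α X i n t =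
      (1 + ε₀) ^ ((5 : ℝ) * n / 2) *
          ∑ i₁, ∑ i₂, (α i₁ i₂ i (0, 0, 0) * (X i₁ n t * X i₂ n t) +
            α i₁ i₂ i (1, 0, 0) * (X i₁ (n + 1) t * X i₂ n t) +
            α i₁ i₂ i (0, 1, 0) * (X i₁ n t * X i₂ (n + 1) t)) +
        (1 + ε₀) ^ ((5 : ℝ) * ((n : ℝ) - 1) / 2) *
          ∑ i₁, ∑ i₂, α i₁ i₂ i (0, 0, 1) * (X i₁ (n - 1) t * X i₂ (n - 1) t) := by
  unfold quadTerm
  simp only [sum_shiftSet, sub_zero, add_zero, Int.cast_zero, Int.cast_one, Finset.mul_sum,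
    ← Finset.sum_add_distrib]
  refine Finset.sum_congr rfl fun i₁ _ => Finset.sum_congr rfl fun i₂ _ => ?_
  ring


/-- `2^{-3/2} = 2^{-5/2} · 2`. [folklore] -/
theorem htcNF_rpow_aux : (2 : ℝ) ^ (-((3 : ℝ) / 2)) = (2 : ℝ) ^ (-((5 : ℝ) / 2)) * 2 := by
  rw [← Real.rpow_add_one two_ne_zero]
  norm_num

end Summit.NavierStokesRegularity.NavierStokesRegularity.Theorems

namespace Summit.NavierStokesRegularity.NavierStokesRegularity.Theorems.HeteroclinicTriggerChain

open Literature.Analysis.FluidPDE Literature.Analysis.FluidPDE.TaoCascade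
open Summit.NavierStokesRegularity.NavierStokesRegularity.Theorems

/-- **Registered stub `stub_normal_form` of crux `TriggerChainFrontStep` (item
stmt-NavierStokesRegularity-22785), verbatim: the normal form of a symmetric cancelling four-mode table
at a diagonal pure-mode saddle.** Hypotheses: symmetry (4.2), cancellation (4.3), (purity) pure-`i₀`
families are zeros of `quadTerm 1 α`, (saddle) the polarisation of `quadTerm 1 α` at `E₋ = δ_{(i₀,0)}` is
diagonal with rate table `d`. Conclusions: see the module docstring. [this file] -/
theorem stub_normal_form : ∀ (α : Fin 4 → Fin 4 → Fin 4 → ℤ × ℤ × ℤ → ℝ) (i₀ : Fin 4) (d : Fin 4 → ℤ → ℝ),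
    Literature.Analysis.FluidPDE.TaoCascade.IsSymmetricCoeff α →
    Literature.Analysis.FluidPDE.TaoCascade.IsCancellingCoeff α →
    (∀ X : Fin 4 → ℤ → ℝ → ℝ, (∀ i n t, i ≠ i₀ → X i n t = 0) →
      ∀ i n t, Literature.Analysis.FluidPDE.TaoCascade.quadTerm 1 α X i n t = 0) →
    (∀ (Y : Fin 4 → ℤ → ℝ → ℝ) (i : Fin 4) (n : ℤ) (t : ℝ),
      Literature.Analysis.FluidPDE.TaoCascade.quadTerm 1 α
          (fun j m s => (fun j m (_ : ℝ) => if j = i₀ ∧ m = 0 then (1 : ℝ) else 0) j m s + Y j m s) i n t -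
        Literature.Analysis.FluidPDE.TaoCascade.quadTerm 1 α
          (fun j m (_ : ℝ) => if j = i₀ ∧ m = 0 then (1 : ℝ) else 0) i n t -
        Literature.Analysis.FluidPDE.TaoCascade.quadTerm 1 α Y i n t = d i n * Y i n t) →
    (∀ (i : Fin 4) (μ : ℤ × ℤ × ℤ), μ ∈ Literature.Analysis.FluidPDE.TaoCascade.shiftSet →
      α i₀ i₀ i μ = 0) ∧
    (∀ j i : Fin 4, α i₀ j i (0, 0, 1) = 0 ∧ α j i₀ i (0, 0, 1) = 0 ∧
      α j i₀ i (1, 0, 0) = 0 ∧ α i₀ j i (0, 1, 0) = 0) ∧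
    (∀ j i : Fin 4, j ≠ i → α i₀ j i (0, 0, 0) = 0 ∧ α j i₀ i (0, 0, 0) = 0 ∧
      α i₀ j i (1, 0, 0) = 0 ∧ α j i₀ i (0, 1, 0) = 0) ∧
    (∀ i : Fin 4, d i 0 = 2 * α i₀ i i (0, 0, 0)) ∧
    (∀ i : Fin 4, d i (-1) = (2 : ℝ) ^ (-((3 : ℝ) / 2)) * α i₀ i i (1, 0, 0)) ∧
    (∀ (i : Fin 4) (n : ℤ), n ≠ 0 → n ≠ -1 → d i n = 0) ∧
    (∀ n : ℤ, d i₀ n = 0) ∧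
    (∀ j₁ j₂ : Fin 4, j₁ ≠ j₂ → α j₁ j₂ i₀ (0, 0, 1) = 0 ∧ α j₁ j₂ i₀ (0, 0, 0) = 0) ∧
    (∀ j : Fin 4, α j j i₀ (0, 0, 0) = -(2 * α i₀ j j (0, 0, 0)) ∧
      α i₀ j j (1, 0, 0) = -(α j j i₀ (0, 0, 1)) / 2 ∧ α j i₀ j (0, 1, 0) = -(α j j i₀ (0, 0, 1)) / 2 ∧
      d j (-1) = -((2 : ℝ) ^ (-((5 : ℝ) / 2))) * α j j i₀ (0, 0, 1)) := by
  intro α i₀ d hsym hcanc hpure hsad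
  -- the four shifts and the symmetry (4.2) on them
  have m000 : ((0 : ℤ), (0 : ℤ), (0 : ℤ)) ∈ shiftSet := by decide
  have m100 : ((1 : ℤ), (0 : ℤ), (0 : ℤ)) ∈ shiftSet := by decide
  have m001 : ((0 : ℤ), (0 : ℤ), (1 : ℤ)) ∈ shiftSet := by decide
  have sym000 : ∀ a b c : Fin 4, α a b c (0, 0, 0) = α b a c (0, 0, 0) :=
    fun a b c => hsym a b c 0 0 0 m000
  have sym100 : ∀ a b c : Fin 4, α a b c (1, 0, 0) = α b a c (0, 1, 0) :=
    fun a b c => hsym a b c 1 0 0 m100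
  have sym001 : ∀ a b c : Fin 4, α a b c (0, 0, 1) = α b a c (0, 0, 1) :=
    fun a b c => hsym a b c 0 0 1 m001
  -- (purity): the three extractions
  have pur000 : ∀ i : Fin 4, α i₀ i₀ i (0, 0, 0) = 0 := by
    intro i
    have h := hpure (fun j m _ => if j = i₀ ∧ m = 0 then (1 : ℝ) else 0)
      (by intro j n t hj; simp [hj]) i 0 0
    rw [htcNF_quadTerm_expand] at h
    simp only [Int.cast_zero, mul_zero, zero_div, Real.rpow_zero, one_mul, and_true] at h
    norm_num at h
    simpa only [Finset.sum_ite_eq', Finset.sum_ite_eq, Finset.mem_univ, if_true] using h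
  have pur001 : ∀ i : Fin 4, α i₀ i₀ i (0, 0, 1) = 0 := by
    intro i
    have h := hpure (fun j m _ => if j = i₀ ∧ m = 0 then (1 : ℝ) else 0)
      (by intro j n t hj; simp [hj]) i 1 0
    rw [htcNF_quadTerm_expand] at h
    simp only [Int.cast_one] at h
    norm_num at h
    simpa only [Finset.sum_ite_eq', Finset.sum_ite_eq, Finset.mem_univ, if_true] using h
  have pur100 : ∀ i : Fin 4, α i₀ i₀ i (1, 0, 0) = 0 ∧ α i₀ i₀ i (0, 1, 0) = 0 := by
    intro i
    have h := hpure (fun j m _ => if j = i₀ ∧ (m = 0 ∨ m = 1) then (1 : ℝ) else 0)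
      (by intro j n t hj; simp [hj]) i 0 0
    rw [htcNF_quadTerm_expand] at h
    simp only [Int.cast_zero, mul_zero, zero_div, Real.rpow_zero, one_mul, and_true, true_or,
      mul_add, Finset.sum_add_distrib] at h
    norm_num at h
    have hs := sym100 i₀ i₀ i
    constructor <;> linarith [pur000 i]
  -- (saddle): the five polarisation identities
  have sadA : ∀ b i : Fin 4, α i₀ b i (0, 0, 0) + α b i₀ i (0, 0, 0) = if i = b then d i 0 else 0 := by
    intro b i
    have h := hsad (fun j m _ => if j = b ∧ m = 0 then (1 : ℝ) else 0) i 0 0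
    rw [htcNF_quadTerm_expand, htcNF_quadTerm_expand, htcNF_quadTerm_expand] at h
    simp only [Int.cast_zero, mul_zero, zero_div, Real.rpow_zero, one_mul, and_true, add_mul, mul_add,
      Finset.sum_add_distrib] at h
    norm_num at h
    rw [← h]
    ring
  have sadB : ∀ b i : Fin 4, α i₀ b i (0, 0, 1) + α b i₀ i (0, 0, 1) = 0 := by
    intro b i
    have h := hsad (fun j m _ => if j = b ∧ m = 0 then (1 : ℝ) else 0) i 1 0
    rw [htcNF_quadTerm_expand, htcNF_quadTerm_expand, htcNF_quadTerm_expand] at h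
    simp only [Int.cast_one, add_mul, mul_add, Finset.sum_add_distrib] at h
    norm_num at h
    linarith
  have sadC : ∀ b i : Fin 4, α b i₀ i (1, 0, 0) + α i₀ b i (0, 1, 0) = 0 := by
    intro b i
    have h := hsad (fun j m _ => if j = b ∧ m = 1 then (1 : ℝ) else 0) i 0 0
    rw [htcNF_quadTerm_expand, htcNF_quadTerm_expand, htcNF_quadTerm_expand] at h
    simp only [Int.cast_zero, mul_zero, zero_div, Real.rpow_zero, one_mul, and_true, add_mul, mul_add,
      Finset.sum_add_distrib] at h
    norm_num at h
    linarith
  have sadD : ∀ b i : Fin 4, (2 : ℝ) ^ (-((5 : ℝ) / 2)) * (α i₀ b i (1, 0, 0) + α b i₀ i (0, 1, 0)) =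
      if i = b then d i (-1) else 0 := by
    intro b i
    have h := hsad (fun j m _ => if j = b ∧ m = -1 then (1 : ℝ) else 0) i (-1) 0
    rw [htcNF_quadTerm_expand, htcNF_quadTerm_expand, htcNF_quadTerm_expand] at h
    simp only [Int.cast_neg, Int.cast_one, and_true, add_mul, mul_add, Finset.sum_add_distrib] at h
    norm_num at h
    rw [← h]
    ring
  have sadF : ∀ (i : Fin 4) (n : ℤ), n ≠ 0 → n ≠ -1 → n ≠ 1 → d i n = 0 := by
    intro i n hn0 hn1 hn2
    have h := hsad (fun j m _ => if j = i ∧ m = n then (1 : ℝ) else 0) i n 0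
    have hn1' : n + 1 ≠ 0 := by omega
    have hn2' : n - 1 ≠ 0 := by omega
    rw [htcNF_quadTerm_expand, htcNF_quadTerm_expand, htcNF_quadTerm_expand] at h
    simp only [hn0, hn1', hn2', and_false, and_true] at h
    norm_num at h
    exact h.symm
  have sadG : ∀ i : Fin 4, d i 1 = 0 := by
    intro i
    have h := hsad (fun j m _ => if j = i ∧ m = 1 then (1 : ℝ) else 0) i 1 0
    rw [htcNF_quadTerm_expand, htcNF_quadTerm_expand, htcNF_quadTerm_expand] at h
    simp only [Int.cast_one, and_true] at h
    norm_num at h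
    exact h.symm
  have hwpos : (0 : ℝ) < (2 : ℝ) ^ (-((5 : ℝ) / 2)) := by positivity
  -- the conjuncts
  have nf1 : ∀ (i : Fin 4) (μ : ℤ × ℤ × ℤ), μ ∈ shiftSet → α i₀ i₀ i μ = 0 := by
    intro i μ hμ
    rcases (mem_shiftSet_iff μ).1 hμ with rfl | rfl | rfl | rfl
    · exact pur000 i
    · exact (pur100 i).1
    · exact (pur100 i).2
    · exact pur001 i
  have nf2 : ∀ j i : Fin 4, α i₀ j i (0, 0, 1) = 0 ∧ α j i₀ i (0, 0, 1) = 0 ∧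
      α j i₀ i (1, 0, 0) = 0 ∧ α i₀ j i (0, 1, 0) = 0 := by
    intro j i
    have h1 := sadB j i
    have h2 := sym001 i₀ j i
    have h3 := sadC j i
    have h4 := sym100 j i₀ i
    exact ⟨by linarith, by linarith, by linarith, by linarith⟩
  have nf3 : ∀ j i : Fin 4, j ≠ i → α i₀ j i (0, 0, 0) = 0 ∧ α j i₀ i (0, 0, 0) = 0 ∧
      α i₀ j i (1, 0, 0) = 0 ∧ α j i₀ i (0, 1, 0) = 0 := by
    intro j i hji
    have hij : ¬ i = j := fun h => hji h.symm
    have h1 := sadA j i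
    rw [if_neg hij] at h1
    have h2 := sym000 i₀ j i
    have h3 := sadD j i
    rw [if_neg hij] at h3
    have h4 := sym100 i₀ j i
    have h5 : α i₀ j i (1, 0, 0) + α j i₀ i (0, 1, 0) = 0 := by
      rcases mul_eq_zero.1 h3 with h | h
      · exact absurd h hwpos.ne'
      · exact h
    exact ⟨by linarith, by linarith, by linarith, by linarith⟩
  have nf4 : ∀ i : Fin 4, d i 0 = 2 * α i₀ i i (0, 0, 0) := by
    intro i
    have h1 := sadA i i
    rw [if_pos rfl] at h1
    have h2 := sym000 i₀ i i
    linarith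
  have nf5 : ∀ i : Fin 4, d i (-1) = (2 : ℝ) ^ (-((3 : ℝ) / 2)) * α i₀ i i (1, 0, 0) := by
    intro i
    have h1 := sadD i i
    rw [if_pos rfl] at h1
    have h2 := sym100 i₀ i i
    rw [← h2] at h1
    rw [htcNF_rpow_aux, ← h1]
    ring
  have nf6 : ∀ (i : Fin 4) (n : ℤ), n ≠ 0 → n ≠ -1 → d i n = 0 := by
    intro i n hn0 hn1
    by_cases hn2 : n = 1
    · subst hn2
      exact sadG i
    · exact sadF i n hn0 hn1 hn2
  have nf7 : ∀ n : ℤ, d i₀ n = 0 := by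
    intro n
    by_cases hn0 : n = 0
    · subst hn0
      rw [nf4, pur000, mul_zero]
    · by_cases hn1 : n = -1
      · subst hn1
        rw [nf5, (pur100 i₀).1, mul_zero]
      · exact nf6 i₀ n hn0 hn1
  have nf8 : ∀ j₁ j₂ : Fin 4, j₁ ≠ j₂ → α j₁ j₂ i₀ (0, 0, 1) = 0 ∧ α j₁ j₂ i₀ (0, 0, 0) = 0 := by
    intro j₁ j₂ hj
    have c1 := hcanc j₁ j₂ i₀ 0 0 1 m001
    have c0 := hcanc j₁ j₂ i₀ 0 0 0 m000
    have h12 := nf3 j₁ j₂ hj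
    have h21 := nf3 j₂ j₁ (Ne.symm hj)
    have s1 := sym001 j₁ j₂ i₀
    have s0 := sym000 j₁ j₂ i₀
    obtain ⟨a1, a2, a3, a4⟩ := h12
    obtain ⟨b1, b2, b3, b4⟩ := h21
    exact ⟨by linarith, by linarith⟩
  have nf9 : ∀ j : Fin 4, α j j i₀ (0, 0, 0) = -(2 * α i₀ j j (0, 0, 0)) ∧
      α i₀ j j (1, 0, 0) = -(α j j i₀ (0, 0, 1)) / 2 ∧ α j i₀ j (0, 1, 0) = -(α j j i₀ (0, 0, 1)) / 2 ∧
      d j (-1) = -((2 : ℝ) ^ (-((5 : ℝ) / 2))) * α j j i₀ (0, 0, 1) := by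
    intro j
    have c0 := hcanc j j i₀ 0 0 0 m000
    have c1 := hcanc j j i₀ 0 0 1 m001
    have s0 := sym000 j i₀ j
    have s1 := sym100 i₀ j j
    have ha : α i₀ j j (1, 0, 0) = -(α j j i₀ (0, 0, 1)) / 2 := by linarith
    refine ⟨by linarith, ha, by linarith, ?_⟩
    rw [nf5 j, htcNF_rpow_aux, ha]
    ring
  exact ⟨nf1, nf2, nf3, nf4, nf5, nf6, nf7, nf8, nf9⟩

end Summit.NavierStokesRegularity.NavierStokesRegularity.Theorems.HeteroclinicTriggerChain

end
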